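import Mathlib.RingTheory.Polynomial.Chebyshev
import Mathlib.Analysis.SpecialFunctions.Trigonometric.Chebyshev.Basic
import Mathlib.Analysis.SpecialFunctions.Trigonometric.Inverse
import HarnessLib

/-!
# The Chebyshev bound `|U_n(x)| ≤ n + 1` and perturbed Chebyshev three-term recurrences

Two classical facts and their standard combination:

* `abs_sin_succ_mul_le` — `|sin((n+1)θ)| ≤ (n+1)|sin θ|`, whence
  `abs_chebyshevU_eval_le` — **`|U_n(x)| ≤ n + 1` for `-1 ≤ x ≤ 1`** [Abramowitz–Stegun 22.14.6]
  (`U_n` = Mathlib's `Polynomial.Chebyshev.U ℝ n`, Chebyshev polynomials of the second kind);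
* the **comparison sequence** `V_k = s^k U_k(y/(2s))` (`s > 0`): it solves the constant-coefficient
  recurrence `V_{k+2} = y V_{k+1} - s² V_k` with `V_0 = 1`, `V_1 = y`, and `|V_k| ≤ (k+1) s^k` in the
  oscillatory regime `y² ≤ 4s²` (`chebyshevCmp_*`);
* the **variation-of-constants (Duhamel) formula** for a second-order linear recurrence written as a
  perturbation of the constant-coefficient one, `Q_{k+2} = y Q_{k+1} - s² Q_k + f_{k+1}`,
  `Q_1 = y Q_0` (`f_0 = 0`): `Q_k = Q_0 V_k + Σ_{j<k} V_{k-1-j} f_j` [Elaydi 1996, §2.4.1]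
  (`duhamel_chebyshev`);
* their combination, the **perturbed Chebyshev bound** (`perturbedChebyshev_abs_le`): if
  `Q_{k+2} = a_{k+1} Q_{k+1} - c_{k+1} Q_k`, `Q_1 = y Q_0`, with a drift `|a_k - y| ≤ k·θ·s` and a damping
  defect `|s² - c_k| ≤ s² ε_k`, and `y² ≤ 4 s²`, then `|Q_k| ≤ |Q_0| s^k M_k` for ANY majorant sequence
  `M` with `M_k ≥ (k+1) + Σ_{1 ≤ j < k} (k-j)(j θ M_j + ε_j M_{j-1})` — the discrete Gronwall iteration of
  the Duhamel formula against `|V_i| ≤ (i+1) s^i`.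

The last statement is the form in which the bound is used for the extremal ratios of the
Laguerre-centred skeleton of the Jensen polynomials of `ξ` (downward Laguerre recurrence at a zero of
`L_{d-1}^{(b-1)}`, where the Ismail–Li zero bracket is exactly the oscillatory condition `y² ≤ 4s²`).

## References
* [AbramowitzStegun1964] M. Abramowitz, I. A. Stegun (eds.), *Handbook of Mathematical Functions*,
  NBS (1964), 22.14.6 (`|U_n(x)| ≤ n+1`, `-1 ≤ x ≤ 1`); 22.7.4 / 22.3 (recurrence and `U_n(cos θ)`).
* [Elaydi1996] S. N. Elaydi, *An Introduction to Difference Equations*, Springer UTM (1996), §2.4.1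
  (the method of variation of constants (parameters)).
-/

open Polynomial Real Finset
open Polynomial.Chebyshev

noncomputable section

namespace Literature.Analysis.SpecialFunctions

/-! ### `|sin((n+1)θ)| ≤ (n+1)|sin θ|` and `|U_n(x)| ≤ n+1` -/

/-- `|sin(n θ)| ≤ n |sin θ|` for every natural `n` (induction on the addition formula).
[cite: AbramowitzStegun1964, 22.14.6] -/
theorem abs_sin_nat_mul_le (n : ℕ) (θ : ℝ) : |sin (n * θ)| ≤ n * |sin θ| := by
  induction n with
  | zero => simp
  | succ n ih =>
    have h : sin ((n + 1 : ℕ) * θ) = sin (n * θ) * cos θ + cos (n * θ) * sin θ := by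
      rw [Nat.cast_succ, add_mul, one_mul, sin_add]
    rw [h, Nat.cast_succ]
    calc |sin (n * θ) * cos θ + cos (n * θ) * sin θ|
        ≤ |sin (n * θ) * cos θ| + |cos (n * θ) * sin θ| := abs_add_le _ _
      _ = |sin (n * θ)| * |cos θ| + |cos (n * θ)| * |sin θ| := by rw [abs_mul, abs_mul]
      _ ≤ |sin (n * θ)| * 1 + 1 * |sin θ| := by
          gcongr
          · exact abs_cos_le_one θ
          · exact abs_cos_le_one _
      _ ≤ n * |sin θ| * 1 + 1 * |sin θ| := by gcongr
      _ = (n + 1) * |sin θ| := by ring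

/-- **Abramowitz–Stegun 22.14.6**: `|U_n(x)| ≤ n + 1` for `-1 ≤ x ≤ 1` (`U_n` the Chebyshev polynomial of
the second kind). Proof: `x = cos θ`, `U_n(cos θ) sin θ = sin((n+1)θ)` and the previous lemma; at
`x = ±1`, `U_n(±1) = (±1)^n (n+1)`. [cite: AbramowitzStegun1964, 22.14.6] -/
theorem abs_chebyshevU_eval_le (n : ℕ) {x : ℝ} (hx : |x| ≤ 1) :
    |(U ℝ n).eval x| ≤ n + 1 := by
  have hx1 : -1 ≤ x := (abs_le.mp hx).1
  have hx2 : x ≤ 1 := (abs_le.mp hx).2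
  by_cases hs : sin (arccos x) = 0
  · -- then `x = ±1`
    have hx0 : x ^ 2 = 1 := by
      have h := sin_sq_add_cos_sq (arccos x)
      rw [cos_arccos hx1 hx2, hs] at h
      nlinarith [h]
    have hx1' : (x - 1) * (x + 1) = 0 := by nlinarith [hx0]
    rcases mul_eq_zero.mp hx1' with h1 | h1
    · rw [sub_eq_zero.mp h1]
      have := U_eval_one ℝ n
      rw [this]
      push_cast
      rw [abs_of_nonneg (by positivity)]
    · rw [eq_neg_of_add_eq_zero_left h1, U_eval_neg, U_eval_one, Int.cast_negOnePow_natCast, abs_mul,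
        abs_pow, abs_neg, abs_one, one_pow, one_mul]
      push_cast
      rw [abs_of_nonneg (by positivity)]
  · have h := U_real_cos (arccos x) n
    rw [cos_arccos hx1 hx2] at h
    have habs : |(U ℝ n).eval x| * |sin (arccos x)| = |sin ((n + 1 : ℕ) * arccos x)| := by
      rw [← abs_mul, h]; push_cast; ring_nf
    have hb := abs_sin_nat_mul_le (n + 1) (arccos x)
    rw [← habs] at hb
    have hpos : 0 < |sin (arccos x)| := abs_pos.mpr hs
    have hb' : |(U ℝ n).eval x| * |sin (arccos x)| ≤ ((n : ℝ) + 1) * |sin (arccos x)| := by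
      have := hb; push_cast at this; linarith
    exact le_of_mul_le_mul_right hb' hpos

/-! ### The comparison sequence `V_k = s^k U_k(y/(2s))` -/

/-- `V_0 = 1`. [cite: AbramowitzStegun1964, 22.7.4] -/
theorem chebyshevCmp_zero (y s : ℝ) : s ^ 0 * (U ℝ (0 : ℕ)).eval (y / (2 * s)) = 1 := by
  simp

/-- `V_1 = y` (`s ≠ 0`). [cite: AbramowitzStegun1964, 22.7.4] -/
theorem chebyshevCmp_one {s : ℝ} (hs : s ≠ 0) (y : ℝ) :
    s ^ 1 * (U ℝ (1 : ℕ)).eval (y / (2 * s)) = y := by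
  simp only [Nat.cast_one, U_one, eval_mul, eval_ofNat, eval_X, pow_one]
  field_simp

/-- The comparison sequence solves `V_{k+2} = y V_{k+1} - s² V_k` (the recurrence
`U_{k+2} = 2x U_{k+1} - U_k` rescaled). [cite: AbramowitzStegun1964, 22.7.4] -/
theorem chebyshevCmp_add_two {s : ℝ} (hs : s ≠ 0) (y : ℝ) (k : ℕ) :
    s ^ (k + 2) * (U ℝ ((k + 2 : ℕ) : ℤ)).eval (y / (2 * s))
      = y * (s ^ (k + 1) * (U ℝ ((k + 1 : ℕ) : ℤ)).eval (y / (2 * s)))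
        - s ^ 2 * (s ^ k * (U ℝ (k : ℤ)).eval (y / (2 * s))) := by
  have h := U_add_two ℝ (k : ℤ)
  push_cast at h ⊢
  rw [h]
  simp only [eval_sub, eval_mul, eval_ofNat, eval_X]
  field_simp
  ring

/-- **Oscillatory bound**: if `s > 0` and `|y| ≤ 2s` then `|V_k| ≤ (k+1) s^k`.
[cite: AbramowitzStegun1964, 22.14.6] -/
theorem abs_chebyshevCmp_le {y s : ℝ} (hs : 0 < s) (hy : |y| ≤ 2 * s) (k : ℕ) :
    |s ^ k * (U ℝ (k : ℤ)).eval (y / (2 * s))| ≤ (k + 1) * s ^ k := by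
  have hw : |y / (2 * s)| ≤ 1 := by
    rw [abs_div, abs_of_pos (by positivity : (0:ℝ) < 2 * s), div_le_one (by positivity)]
    exact hy
  rw [abs_mul, abs_pow, abs_of_pos hs, mul_comm]
  exact mul_le_mul_of_nonneg_right (abs_chebyshevU_eval_le k hw) (pow_nonneg hs.le k)

/-! ### Variation of constants (Duhamel) -/

/-- **Variation of constants** [Elaydi 1996, §2.4.1] for a second-order linear recurrence written as
a perturbation of a constant-coefficient one: if `V` solves `V_{i+2} = y V_{i+1} - λ V_i`, `V_0 = 1`,
`V_1 = y`, and `Q_1 = y Q_0`, `f_0 = 0`, `f_{j+1} = Q_{j+2} - y Q_{j+1} + λ Q_j`, then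
`Q_k = Q_0 V_k + Σ_{j<k} V_{k-1-j} f_j` for every `k`. [cite: Elaydi1996, §2.4.1] -/
theorem duhamel_three_term {Q f V : ℕ → ℝ} {y lam : ℝ} (hV0 : V 0 = 1) (hV1 : V 1 = y)
    (hVrec : ∀ i, V (i + 2) = y * V (i + 1) - lam * V i) (hQ1 : Q 1 = y * Q 0)
    (hf0 : f 0 = 0) (hf : ∀ j, f (j + 1) = Q (j + 2) - y * Q (j + 1) + lam * Q j) :
    ∀ k, Q k = Q 0 * V k + ∑ j ∈ range k, V (k - 1 - j) * f j := by
  intro k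
  induction k using Nat.twoStepInduction with
  | zero => simp [hV0]
  | one => rw [sum_range_one, hQ1, hV1, show 1 - 1 - 0 = 0 by rfl, hV0, hf0]; ring
  | more k ih1 ih2 =>
    have hQ : Q (k + 2) = y * Q (k + 1) - lam * Q k + f (k + 1) := by rw [hf k]; ring
    rw [hQ, ih2, ih1]
    rw [show k + 2 = k + 1 + 1 from rfl, sum_range_succ _ (k + 1), sum_range_succ _ k,
      sum_range_succ _ k]
    have e0 : V (k + 1 + 1 - 1 - (k + 1)) = 1 := by rw [show k + 1 + 1 - 1 - (k + 1) = 0 by omega, hV0]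
    have e1 : V (k + 1 + 1 - 1 - k) = y := by rw [show k + 1 + 1 - 1 - k = 1 by omega, hV1]
    have e2 : V (k + 1 - 1 - k) = 1 := by rw [show k + 1 - 1 - k = 0 by omega, hV0]
    have key : ∑ j ∈ range k, V (k + 1 + 1 - 1 - j) * f j
        = y * ∑ j ∈ range k, V (k + 1 - 1 - j) * f j - lam * ∑ j ∈ range k, V (k - 1 - j) * f j := by
      rw [mul_sum, mul_sum, ← sum_sub_distrib]
      refine sum_congr rfl fun j hj => ?_
      have hj := mem_range.mp hj
      rw [show k + 1 + 1 - 1 - j = (k - 1 - j) + 2 by omega,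
        show k + 1 - 1 - j = (k - 1 - j) + 1 by omega, hVrec]
      ring
    rw [key, e0, e1, e2, hVrec k]
    ring

/-! ### The perturbed Chebyshev bound -/

/-- **Perturbed Chebyshev recurrence bound.** Let `Q_{k+2} = a_{k+1} Q_{k+1} - c_{k+1} Q_k` (`k ≥ 0`),
`Q_1 = y Q_0`, with `s > 0`, `y² ≤ 4s²` (oscillatory regime), a linear drift `|a_k - y| ≤ k·θ·s` and a
damping defect `|s² - c_k| ≤ s²·ε_k` (`θ, ε_k ≥ 0`). Then for every majorant sequence `M` with
`M_k ≥ (k+1) + Σ_{1 ≤ j < k} (k-j)·(j·θ·M_j + ε_j·M_{j-1})` one has `|Q_k| ≤ |Q_0|·s^k·M_k` for all `k`.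
(Variation of constants against `V_i = s^i U_i(y/2s)`, `|V_i| ≤ (i+1)s^i`, and induction.)
[cite: Elaydi1996, §2.4.1] -/
theorem perturbedChebyshev_abs_le {Q a c ε M : ℕ → ℝ} {y s θ : ℝ} (hs : 0 < s)
    (hy : |y| ≤ 2 * s) (hθ : 0 ≤ θ) (hε : ∀ k, 0 ≤ ε k) (hQ1 : Q 1 = y * Q 0)
    (hrec : ∀ k, Q (k + 2) = a (k + 1) * Q (k + 1) - c (k + 1) * Q k)
    (ha : ∀ k, 1 ≤ k → |a k - y| ≤ k * θ * s) (hc : ∀ k, 1 ≤ k → |s ^ 2 - c k| ≤ s ^ 2 * ε k)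
    (hM : ∀ k : ℕ, (k + 1 : ℝ) + ∑ j ∈ Ico 1 k, ((k : ℝ) - j) * (j * θ * M j + ε j * M (j - 1)) ≤ M k) :
    ∀ k, |Q k| ≤ |Q 0| * s ^ k * M k := by
  have hs0 : s ≠ 0 := hs.ne'
  -- the forcing
  set f : ℕ → ℝ := fun j => if j = 0 then 0 else Q (j + 1) - y * Q j + s ^ 2 * Q (j - 1) with hf
  have hf0 : f 0 = 0 := by simp [hf]
  have hf' : ∀ j, f (j + 1) = Q (j + 2) - y * Q (j + 1) + s ^ 2 * Q j := fun j => by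
    simp [hf]
  -- size of the forcing: `|f_j| ≤ jθs|Q_j| + s²ε_j|Q_{j-1}|` for `j ≥ 1`
  have hfb : ∀ j, 1 ≤ j → |f j| ≤ j * θ * s * |Q j| + s ^ 2 * ε j * |Q (j - 1)| := by
    intro j hj
    obtain ⟨i, rfl⟩ : ∃ i, j = i + 1 := ⟨j - 1, by omega⟩
    have e : f (i + 1) = (a (i + 1) - y) * Q (i + 1) + (s ^ 2 - c (i + 1)) * Q i := by
      rw [hf' i, hrec i]; ring
    rw [e, show i + 1 - 1 = i by omega]
    calc |(a (i + 1) - y) * Q (i + 1) + (s ^ 2 - c (i + 1)) * Q i|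
        ≤ |(a (i + 1) - y) * Q (i + 1)| + |(s ^ 2 - c (i + 1)) * Q i| := abs_add_le _ _
      _ = |a (i + 1) - y| * |Q (i + 1)| + |s ^ 2 - c (i + 1)| * |Q i| := by rw [abs_mul, abs_mul]
      _ ≤ ((i + 1 : ℕ) : ℝ) * θ * s * |Q (i + 1)| + s ^ 2 * ε (i + 1) * |Q i| := by
          gcongr
          · exact ha (i + 1) hj
          · exact hc (i + 1) hj
  -- Duhamel against the comparison sequence
  have hD := duhamel_three_term (V := fun i => s ^ i * (U ℝ (i : ℤ)).eval (y / (2 * s)))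
    (by simp) (by simpa using chebyshevCmp_one hs0 y) (fun i => by simpa using chebyshevCmp_add_two hs0 y i)
    hQ1 hf0 hf'
  -- comparison sequence bound
  have hV : ∀ i : ℕ, |s ^ i * (U ℝ (i : ℤ)).eval (y / (2 * s))| ≤ (i + 1) * s ^ i :=
    fun i => abs_chebyshevCmp_le hs hy i
  -- strong induction
  intro k
  induction k using Nat.strong_induction_on with
  | _ k ih =>
    rw [hD k]
    have hQ0 : 0 ≤ |Q 0| := abs_nonneg _
    -- homogeneous part
    have h1 : |Q 0 * (s ^ k * (U ℝ (k : ℤ)).eval (y / (2 * s)))| ≤ |Q 0| * ((k + 1) * s ^ k) := by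
      rw [abs_mul]; exact mul_le_mul_of_nonneg_left (hV k) hQ0
    -- forced part, term by term
    have h2 : ∀ j ∈ range k,
        |(s ^ (k - 1 - j) * (U ℝ ((k - 1 - j : ℕ) : ℤ)).eval (y / (2 * s))) * f j|
          ≤ if j = 0 then 0 else
            |Q 0| * s ^ k * (((k : ℝ) - j) * (j * θ * M j + ε j * M (j - 1))) := by
      intro j hj
      have hjk := mem_range.mp hj
      by_cases hj0 : j = 0
      · subst hj0; simp [hf0]
      rw [if_neg hj0]
      have hj1 : 1 ≤ j := Nat.one_le_iff_ne_zero.mpr hj0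
      rw [abs_mul]
      have hVj := hV (k - 1 - j)
      have hfj := hfb j hj1
      have ihj := ih j hjk
      have ihj1 := ih (j - 1) (by omega)
      -- combine
      have hcast : (((k - 1 - j : ℕ) : ℝ) + 1) = (k : ℝ) - j := by
        rw [Nat.cast_sub (by omega), Nat.cast_sub (by omega)]; push_cast; ring
      calc |s ^ (k - 1 - j) * (U ℝ ((k - 1 - j : ℕ) : ℤ)).eval (y / (2 * s))| * |f j|
          ≤ ((((k - 1 - j : ℕ) : ℝ) + 1) * s ^ (k - 1 - j))
              * (j * θ * s * |Q j| + s ^ 2 * ε j * |Q (j - 1)|) :=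
            mul_le_mul hVj hfj (abs_nonneg _) (by positivity)
        _ ≤ ((((k - 1 - j : ℕ) : ℝ) + 1) * s ^ (k - 1 - j))
              * (j * θ * s * (|Q 0| * s ^ j * M j) + s ^ 2 * ε j * (|Q 0| * s ^ (j - 1) * M (j - 1))) := by
            have hε' := hε j
            gcongr
        _ = |Q 0| * s ^ k * (((k : ℝ) - j) * (j * θ * M j + ε j * M (j - 1))) := by
            rw [hcast]
            have e1 : s ^ (k - 1 - j) * s * s ^ j = s ^ k := by
              rw [← pow_succ, ← pow_add]; congr 1; omega
            have e2 : s ^ (k - 1 - j) * s ^ 2 * s ^ (j - 1) = s ^ k := by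
              rw [← pow_add, ← pow_add]; congr 1; omega
            calc ((k : ℝ) - j) * s ^ (k - 1 - j)
                  * (j * θ * s * (|Q 0| * s ^ j * M j) + s ^ 2 * ε j * (|Q 0| * s ^ (j - 1) * M (j - 1)))
                = ((k : ℝ) - j) * |Q 0| * (j * θ * M j * (s ^ (k - 1 - j) * s * s ^ j)
                    + ε j * M (j - 1) * (s ^ (k - 1 - j) * s ^ 2 * s ^ (j - 1))) := by ring
              _ = |Q 0| * s ^ k * (((k : ℝ) - j) * (j * θ * M j + ε j * M (j - 1))) := by
                    rw [e1, e2]; ring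
    -- sum up
    have h3 := (abs_sum_le_sum_abs _ _).trans (sum_le_sum h2)
    have h4 : ∑ j ∈ range k, (if j = 0 then (0 : ℝ) else
        |Q 0| * s ^ k * (((k : ℝ) - j) * (j * θ * M j + ε j * M (j - 1))))
        = |Q 0| * s ^ k * ∑ j ∈ Ico 1 k, ((k : ℝ) - j) * (j * θ * M j + ε j * M (j - 1)) := by
      rcases Nat.eq_zero_or_pos k with rfl | hk
      · simp
      · rw [Finset.range_eq_Ico, Finset.sum_eq_sum_Ico_succ_bot hk, if_pos rfl, zero_add, mul_sum]
        refine sum_congr rfl fun j hj => ?_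
        rw [if_neg (by have := (mem_Ico.mp hj).1; omega)]
    calc |Q 0 * (s ^ k * (U ℝ (k : ℤ)).eval (y / (2 * s)))
          + ∑ j ∈ range k, (s ^ (k - 1 - j) * (U ℝ ((k - 1 - j : ℕ) : ℤ)).eval (y / (2 * s))) * f j|
        ≤ |Q 0 * (s ^ k * (U ℝ (k : ℤ)).eval (y / (2 * s)))|
          + |∑ j ∈ range k, (s ^ (k - 1 - j) * (U ℝ ((k - 1 - j : ℕ) : ℤ)).eval (y / (2 * s))) * f j| :=
          abs_add_le _ _
      _ ≤ |Q 0| * ((k + 1) * s ^ k)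
          + |Q 0| * s ^ k * ∑ j ∈ Ico 1 k, ((k : ℝ) - j) * (j * θ * M j + ε j * M (j - 1)) := by
          rw [← h4]; exact add_le_add h1 h3
      _ = |Q 0| * s ^ k
          * ((k + 1 : ℝ) + ∑ j ∈ Ico 1 k, ((k : ℝ) - j) * (j * θ * M j + ε j * M (j - 1))) := by ring
      _ ≤ |Q 0| * s ^ k * M k := mul_le_mul_of_nonneg_left (hM k) (by positivity)

end Literature.Analysis.SpecialFunctions

end
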